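import Summits.CriticalPhenomena.PercolationContinuityZ3.Theorems.Transplant.FKConnectivityAllQAntipodalAnd4Series
import HarnessLib

/-!
# Connectivity correlation inequalities for `φ_{w,q}`, every `q > 0` — file 32: `C_∞(and)` AT EVERY LEVEL — the GENERAL SERIES JUNCTION
# IDENTITY (arbitrary attached edge sets on both sides of the pair; the series identities of files 27 and 31 are its specialisations)

Support file (`--supports stmt-CriticalPhenomena-4575`), FK sub-lane `prim-bschramm-fk-2` (gen 19) of the post-continuity programme; builds
on p205010 (kernel theorem, internal audit signed; external expert review pending).  No definitions, no named facts, no sorries; standard axioms.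

THE GENERAL AND-DRIFT.  For a free edge set `N`, an `S`-side attached set `A` (the AND edges other than the root, together with the contracted
edges) and a contracted set `C` (attached on both sides), the drift against a test function `h` is
`∑_{γ ⊆ N} (q^{k(γ ∪ A ∪ st) + k((N\γ) ∪ C)} - q^{k((N\γ) ∪ A ∪ st) + k(γ ∪ C)}) h(γ)` (root edge `st`); gen 10's Conjecture `C_∞` for the AND
type `1_{S ⊆ ω}`, `S = (A \ C) ∪ {st}`, in its coefficientwise form (contracted set `C`, gen 11's `apPsiC`) says this is `≤ 0` for `h` increasing
and `0 < q ≤ 1` whenever the host minus the root is two-terminal series–parallel between `s, t`.  THIS FILE: the SERIES step.  Let the host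
minus `st` be `E₁(s,m) · E₂(m,t)`, `N = N₁ ⊔ N₂`, `A = A₁ ⊔ A₂`, `C = C₁ ⊔ C₂` split along the parts.  For `γ = γ₁ ⊔ γ₂` write `ωᵢ = γᵢ ∪ Aᵢ`,
`φᵢ = γᵢ ∪ Cᵢ` (bars: `γᵢ ↦ Nᵢ \ γᵢ`), `Kᵢ = k(ωᵢ)`, `Φᵢ = k(φᵢ)`, `Y₁ = k(ω₁ ∪ sm)`, `Y₂ = k(ω₂ ∪ mt)`, `σ₁ = 1{s ↔ m in ω₁}`, `σ̄₂ = 1{m ↔ t in ω̄₂}`.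
Then (`andGen_summand_series`)
`q^{2|V|+1} 𝔞(γ) = σ̄₂ q^{K̄₂+Φ₂+1}(q^{Y₁+Φ̄₁} - q^{Ȳ₁+Φ₁}) + (1-σ̄₂) q^{K̄₂+Φ₂}(q^{K₁+Φ̄₁} - q^{K̄₁+Φ₁}) + σ₁ q^{K₁+Φ̄₁+1}(q^{Y₂+Φ̄₂} - q^{Ȳ₂+Φ₂})
  + (1-σ₁) q^{K₁+Φ̄₁}(q^{K₂+Φ̄₂} - q^{K̄₂+Φ₂})`
— the four side functionals are the general AND-drifts of side 1 with root `sm` (attached `A₁`, contracted `C₁`), of side 1 WITHOUT root, and the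
mirror ones of side 2; exactly the identity of file 27 (`A₁ = {ab}`, `C = ∅`) with opaque attached sets (verified on configurations with arbitrary
`Aᵢ, Cᵢ`, explore/gen_verify.py).  Summing: **`andGen_series_nonpos`**.  With the general parallel step (file 32a), the doubled-root lemma and
Duffin re-rooting (file 32b) this drives the induction of file 32c: `C_∞(and)` for EVERY edge set `S` through the root on every 2-connected
series–parallel graph, in the coefficientwise (`apPsiC`) form.
[cite: Grimmett2006, §1.4 eq. (1.20) (p. 15); §3.8 Thm. (3.90) (pp. 61–62); §3.9 (pp. 63–64)] [cite: Wagner2006, Thm. 5.8(d), §5.3]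
-/

noncomputable section

namespace Summit.CriticalPhenomena.PercolationContinuityZ3.Theorems

namespace FK

open SimpleGraph Literature.Probability.LatticeModels Literature.Probability.Percolation
open scoped Classical

variable {V : Type*} [Fintype V]

section GenSeries

variable {E₁ E₂ : Finset (Sym2 V)} {V₁ V₂ : Set V} {s m t : V}

/-- **General series junction, the `S`-side exponent**: for `X ⊆ E₁`, `Y ⊆ E₂` (parts meeting only in `m`; `s` off `E₂`, `t` off `E₁`):
`k(X ∪ Y ∪ st) + |V| + 1 = k(X) + k(Y) + 1{s ↔ m in X and m ↔ t in Y}`. [cite: Grimmett2006, §3.8 (pp. 61–62)] -/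
theorem clusterCount_junction_genSeries (h₁ : ∀ e ∈ (↑E₁ : Set (Sym2 V)), ∀ z ∈ e, z ∈ V₁)
    (h₂ : ∀ e ∈ (↑E₂ : Set (Sym2 V)), ∀ z ∈ e, z ∈ V₂) (hS : V₁ ∩ V₂ ⊆ {m}) (hsV₂ : s ∉ V₂) (htV₁ : t ∉ V₁)
    (hsm : s ≠ m) (htm : t ≠ m) (hst : s ≠ t) {X Y : Finset (Sym2 V)} (hX : X ⊆ E₁) (hY : Y ⊆ E₂) :
    clusterCount (↑(insert s(s, t) (X ∪ Y)) : BondConfig V) ∅ + Fintype.card V + 1 =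
      clusterCount (↑X : BondConfig V) ∅ + clusterCount (↑Y : BondConfig V) ∅ +
        (if (openGraph (↑X : BondConfig V)).Reachable s m ∧ (openGraph (↑Y : BondConfig V)).Reachable m t then 1 else 0) := by
  have kser := clusterCount_union_series h₁ h₂ hS hX hY
  have kins := clusterCount_insert_add_ite (X ∪ Y) s t
  have hreach : (openGraph (↑(X ∪ Y) : BondConfig V)).Reachable s t ↔
      (openGraph (↑X : BondConfig V)).Reachable s m ∧ (openGraph (↑Y : BondConfig V)).Reachable m t := by
    rw [Finset.coe_union]
    exact reachable_series_iff h₁ h₂ hS (Finset.coe_subset.2 hX) (Finset.coe_subset.2 hY) hsV₂ htV₁ hsm htm hst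
  by_cases hr : (openGraph (↑X : BondConfig V)).Reachable s m ∧ (openGraph (↑Y : BondConfig V)).Reachable m t
  · rw [if_pos (hreach.2 hr)] at kins; rw [if_pos hr]; omega
  · rw [if_neg (fun h => hr (hreach.1 h))] at kins; rw [if_neg hr]; omega

set_option linter.unusedSimpArgs false in
/-- **THE GENERAL SERIES JUNCTION IDENTITY (pointwise).**  With `ωᵢ = γᵢ ∪ Aᵢ`, `ω̄ᵢ = (Nᵢ \ γᵢ) ∪ Aᵢ`, `φᵢ = γᵢ ∪ Cᵢ`, `φ̄ᵢ = (Nᵢ \ γᵢ) ∪ Cᵢ`,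
`Kᵢ = k(ωᵢ)`, `Φᵢ = k(φᵢ)`, `Y₁ = k(ω₁ ∪ sm)`, `Y₂ = k(ω₂ ∪ mt)` (bars alike), `σ₁ = 1{s ↔ m in ω₁}`, `σ̄₂ = 1{m ↔ t in ω̄₂}`:
`q^{2|V|+1}(q^{k(ω₁∪ω₂∪st)+k(φ̄₁∪φ̄₂)} - q^{k(ω̄₁∪ω̄₂∪st)+k(φ₁∪φ₂)}) = σ̄₂ q^{K̄₂+Φ₂+1}(q^{Y₁+Φ̄₁} - q^{Ȳ₁+Φ₁}) + (1-σ̄₂) q^{K̄₂+Φ₂}(q^{K₁+Φ̄₁} - q^{K̄₁+Φ₁})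
  + σ₁ q^{K₁+Φ̄₁+1}(q^{Y₂+Φ̄₂} - q^{Ȳ₂+Φ₂}) + (1-σ₁) q^{K₁+Φ̄₁}(q^{K₂+Φ̄₂} - q^{K̄₂+Φ₂})`. [cite: Grimmett2006, §3.8 (pp. 61–62)] -/
theorem andGen_summand_series (q : ℝ) (h₁ : ∀ e ∈ (↑E₁ : Set (Sym2 V)), ∀ z ∈ e, z ∈ V₁)
    (h₂ : ∀ e ∈ (↑E₂ : Set (Sym2 V)), ∀ z ∈ e, z ∈ V₂) (hS : V₁ ∩ V₂ ⊆ {m}) (hsV₂ : s ∉ V₂) (htV₁ : t ∉ V₁)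
    (hsm : s ≠ m) (htm : t ≠ m) (hst : s ≠ t)
    {N₁ A₁ C₁ N₂ A₂ C₂ γ₁ γ₂ : Finset (Sym2 V)} (hN₁ : N₁ ⊆ E₁) (hA₁ : A₁ ⊆ E₁) (hC₁ : C₁ ⊆ E₁)
    (hN₂ : N₂ ⊆ E₂) (hA₂ : A₂ ⊆ E₂) (hC₂ : C₂ ⊆ E₂) (hγ₁ : γ₁ ⊆ N₁) (hγ₂ : γ₂ ⊆ N₂) (x : ℝ) :
    q ^ (2 * Fintype.card V + 1) *
        ((q ^ (clusterCount (↑(insert s(s, t) ((γ₁ ∪ A₁) ∪ (γ₂ ∪ A₂))) : BondConfig V) ∅ +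
              clusterCount (↑((N₁ \ γ₁ ∪ C₁) ∪ (N₂ \ γ₂ ∪ C₂)) : BondConfig V) ∅) -
          q ^ (clusterCount (↑(insert s(s, t) ((N₁ \ γ₁ ∪ A₁) ∪ (N₂ \ γ₂ ∪ A₂))) : BondConfig V) ∅ +
              clusterCount (↑((γ₁ ∪ C₁) ∪ (γ₂ ∪ C₂)) : BondConfig V) ∅)) * x) =
      (if (openGraph (↑(N₂ \ γ₂ ∪ A₂) : BondConfig V)).Reachable m t then 1 else 0) *
          q ^ (clusterCount (↑(N₂ \ γ₂ ∪ A₂) : BondConfig V) ∅ + clusterCount (↑(γ₂ ∪ C₂) : BondConfig V) ∅ + 1) *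
          ((q ^ (clusterCount (↑(insert s(s, m) (γ₁ ∪ A₁)) : BondConfig V) ∅ + clusterCount (↑(N₁ \ γ₁ ∪ C₁) : BondConfig V) ∅) -
            q ^ (clusterCount (↑(insert s(s, m) (N₁ \ γ₁ ∪ A₁)) : BondConfig V) ∅ + clusterCount (↑(γ₁ ∪ C₁) : BondConfig V) ∅)) * x) +
      (if (openGraph (↑(N₂ \ γ₂ ∪ A₂) : BondConfig V)).Reachable m t then 0 else 1) *
          q ^ (clusterCount (↑(N₂ \ γ₂ ∪ A₂) : BondConfig V) ∅ + clusterCount (↑(γ₂ ∪ C₂) : BondConfig V) ∅) *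
          ((q ^ (clusterCount (↑(γ₁ ∪ A₁) : BondConfig V) ∅ + clusterCount (↑(N₁ \ γ₁ ∪ C₁) : BondConfig V) ∅) -
            q ^ (clusterCount (↑(N₁ \ γ₁ ∪ A₁) : BondConfig V) ∅ + clusterCount (↑(γ₁ ∪ C₁) : BondConfig V) ∅)) * x) +
      (if (openGraph (↑(γ₁ ∪ A₁) : BondConfig V)).Reachable s m then 1 else 0) *
          q ^ (clusterCount (↑(γ₁ ∪ A₁) : BondConfig V) ∅ + clusterCount (↑(N₁ \ γ₁ ∪ C₁) : BondConfig V) ∅ + 1) *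
          ((q ^ (clusterCount (↑(insert s(m, t) (γ₂ ∪ A₂)) : BondConfig V) ∅ + clusterCount (↑(N₂ \ γ₂ ∪ C₂) : BondConfig V) ∅) -
            q ^ (clusterCount (↑(insert s(m, t) (N₂ \ γ₂ ∪ A₂)) : BondConfig V) ∅ + clusterCount (↑(γ₂ ∪ C₂) : BondConfig V) ∅)) * x) +
      (if (openGraph (↑(γ₁ ∪ A₁) : BondConfig V)).Reachable s m then 0 else 1) *
          q ^ (clusterCount (↑(γ₁ ∪ A₁) : BondConfig V) ∅ + clusterCount (↑(N₁ \ γ₁ ∪ C₁) : BondConfig V) ∅) *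
          ((q ^ (clusterCount (↑(γ₂ ∪ A₂) : BondConfig V) ∅ + clusterCount (↑(N₂ \ γ₂ ∪ C₂) : BondConfig V) ∅) -
            q ^ (clusterCount (↑(N₂ \ γ₂ ∪ A₂) : BondConfig V) ∅ + clusterCount (↑(γ₂ ∪ C₂) : BondConfig V) ∅)) * x) := by
  -- containments of the attached configurations
  have hω₁ : γ₁ ∪ A₁ ⊆ E₁ := Finset.union_subset (hγ₁.trans hN₁) hA₁
  have hωb₁ : N₁ \ γ₁ ∪ A₁ ⊆ E₁ := Finset.union_subset (Finset.sdiff_subset.trans hN₁) hA₁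
  have hω₂ : γ₂ ∪ A₂ ⊆ E₂ := Finset.union_subset (hγ₂.trans hN₂) hA₂
  have hωb₂ : N₂ \ γ₂ ∪ A₂ ⊆ E₂ := Finset.union_subset (Finset.sdiff_subset.trans hN₂) hA₂
  have hφ₁ : γ₁ ∪ C₁ ⊆ E₁ := Finset.union_subset (hγ₁.trans hN₁) hC₁
  have hφb₁ : N₁ \ γ₁ ∪ C₁ ⊆ E₁ := Finset.union_subset (Finset.sdiff_subset.trans hN₁) hC₁
  have hφ₂ : γ₂ ∪ C₂ ⊆ E₂ := Finset.union_subset (hγ₂.trans hN₂) hC₂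
  have hφb₂ : N₂ \ γ₂ ∪ C₂ ⊆ E₂ := Finset.union_subset (Finset.sdiff_subset.trans hN₂) hC₂
  -- junction bookkeeping for the four exponents of the left-hand side
  have eS := clusterCount_junction_genSeries h₁ h₂ hS hsV₂ htV₁ hsm htm hst hω₁ hω₂
  have eSb := clusterCount_junction_genSeries h₁ h₂ hS hsV₂ htV₁ hsm htm hst hωb₁ hωb₂
  have eC := clusterCount_union_series h₁ h₂ hS hφb₁ hφb₂
  have eG := clusterCount_union_series h₁ h₂ hS hφ₁ hφ₂
  -- the virtual terminal edges `sm`, `mt`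
  have y₁ := clusterCount_insert_add_ite (γ₁ ∪ A₁) s m
  have yb₁ := clusterCount_insert_add_ite (N₁ \ γ₁ ∪ A₁) s m
  have y₂ := clusterCount_insert_add_ite (γ₂ ∪ A₂) m t
  have yb₂ := clusterCount_insert_add_ite (N₂ \ γ₂ ∪ A₂) m t
  -- abbreviate the atoms
  set KS := clusterCount (↑(insert s(s, t) ((γ₁ ∪ A₁) ∪ (γ₂ ∪ A₂))) : BondConfig V) ∅
  set KSb := clusterCount (↑(insert s(s, t) ((N₁ \ γ₁ ∪ A₁) ∪ (N₂ \ γ₂ ∪ A₂))) : BondConfig V) ∅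
  set KC := clusterCount (↑((N₁ \ γ₁ ∪ C₁) ∪ (N₂ \ γ₂ ∪ C₂)) : BondConfig V) ∅
  set KG := clusterCount (↑((γ₁ ∪ C₁) ∪ (γ₂ ∪ C₂)) : BondConfig V) ∅
  set K₁ := clusterCount (↑(γ₁ ∪ A₁) : BondConfig V) ∅
  set Kb₁ := clusterCount (↑(N₁ \ γ₁ ∪ A₁) : BondConfig V) ∅
  set K₂ := clusterCount (↑(γ₂ ∪ A₂) : BondConfig V) ∅
  set Kb₂ := clusterCount (↑(N₂ \ γ₂ ∪ A₂) : BondConfig V) ∅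
  set P₁ := clusterCount (↑(γ₁ ∪ C₁) : BondConfig V) ∅
  set Pb₁ := clusterCount (↑(N₁ \ γ₁ ∪ C₁) : BondConfig V) ∅
  set P₂ := clusterCount (↑(γ₂ ∪ C₂) : BondConfig V) ∅
  set Pb₂ := clusterCount (↑(N₂ \ γ₂ ∪ C₂) : BondConfig V) ∅
  set Y₁ := clusterCount (↑(insert s(s, m) (γ₁ ∪ A₁)) : BondConfig V) ∅
  set Yb₁ := clusterCount (↑(insert s(s, m) (N₁ \ γ₁ ∪ A₁)) : BondConfig V) ∅
  set Y₂ := clusterCount (↑(insert s(m, t) (γ₂ ∪ A₂)) : BondConfig V) ∅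
  set Yb₂ := clusterCount (↑(insert s(m, t) (N₂ \ γ₂ ∪ A₂)) : BondConfig V) ∅
  -- the left-hand side as one power
  have lhs1 : q ^ (2 * Fintype.card V + 1) * q ^ (KS + KC) = q ^ (KS + Fintype.card V + 1 + (KC + Fintype.card V)) := by
    rw [← pow_add]; congr 1; omega
  have lhs2 : q ^ (2 * Fintype.card V + 1) * q ^ (KSb + KG) = q ^ (KSb + Fintype.card V + 1 + (KG + Fintype.card V)) := by
    rw [← pow_add]; congr 1; omega
  have expand : q ^ (2 * Fintype.card V + 1) * ((q ^ (KS + KC) - q ^ (KSb + KG)) * x) =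
      (q ^ (KS + Fintype.card V + 1 + (KC + Fintype.card V)) - q ^ (KSb + Fintype.card V + 1 + (KG + Fintype.card V))) * x := by
    rw [← lhs1, ← lhs2]; ring
  rw [expand, eS, eSb, eC, eG]
  by_cases r₁ : (openGraph (↑(γ₁ ∪ A₁) : BondConfig V)).Reachable s m <;>
  by_cases rb₁ : (openGraph (↑(N₁ \ γ₁ ∪ A₁) : BondConfig V)).Reachable s m <;>
  by_cases r₂ : (openGraph (↑(γ₂ ∪ A₂) : BondConfig V)).Reachable m t <;>
  by_cases rb₂ : (openGraph (↑(N₂ \ γ₂ ∪ A₂) : BondConfig V)).Reachable m t <;>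
  simp only [r₁, rb₁, r₂, rb₂, and_self, and_true, true_and, and_false, false_and, if_true, if_false,
    not_false_eq_true, not_true_eq_false, add_zero] at y₁ yb₁ y₂ yb₂ ⊢ <;>
  (rw [← y₁, ← yb₁, ← y₂, ← yb₂]; ring)

/-- **THE GENERAL SERIES JUNCTION IDENTITY (summed).** [cite: Grimmett2006, §3.8 Thm. (3.90) (pp. 61–62)] -/
theorem andGen_series_eq (q : ℝ) (h₁ : ∀ e ∈ (↑E₁ : Set (Sym2 V)), ∀ z ∈ e, z ∈ V₁)
    (h₂ : ∀ e ∈ (↑E₂ : Set (Sym2 V)), ∀ z ∈ e, z ∈ V₂) (hS : V₁ ∩ V₂ ⊆ {m}) (hsV₂ : s ∉ V₂) (htV₁ : t ∉ V₁)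
    (hsm : s ≠ m) (htm : t ≠ m) (hst : s ≠ t)
    {N₁ A₁ C₁ N₂ A₂ C₂ : Finset (Sym2 V)} (hd : Disjoint N₁ N₂) (hN₁ : N₁ ⊆ E₁) (hA₁ : A₁ ⊆ E₁) (hC₁ : C₁ ⊆ E₁)
    (hN₂ : N₂ ⊆ E₂) (hA₂ : A₂ ⊆ E₂) (hC₂ : C₂ ⊆ E₂) (g : Finset (Sym2 V) → ℝ) :
    q ^ (2 * Fintype.card V + 1) *
        ∑ γ ∈ (N₁ ∪ N₂).powerset,
          (q ^ (clusterCount (↑(insert s(s, t) (γ ∪ (A₁ ∪ A₂))) : BondConfig V) ∅ +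
                clusterCount (↑((N₁ ∪ N₂) \ γ ∪ (C₁ ∪ C₂)) : BondConfig V) ∅) -
            q ^ (clusterCount (↑(insert s(s, t) ((N₁ ∪ N₂) \ γ ∪ (A₁ ∪ A₂))) : BondConfig V) ∅ +
                clusterCount (↑(γ ∪ (C₁ ∪ C₂)) : BondConfig V) ∅)) * g γ =
      ∑ γ₂ ∈ N₂.powerset,
          ((if (openGraph (↑(N₂ \ γ₂ ∪ A₂) : BondConfig V)).Reachable m t then 1 else 0) *
              q ^ (clusterCount (↑(N₂ \ γ₂ ∪ A₂) : BondConfig V) ∅ + clusterCount (↑(γ₂ ∪ C₂) : BondConfig V) ∅ + 1) *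
              ∑ γ₁ ∈ N₁.powerset, (q ^ (clusterCount (↑(insert s(s, m) (γ₁ ∪ A₁)) : BondConfig V) ∅ + clusterCount (↑(N₁ \ γ₁ ∪ C₁) : BondConfig V) ∅) -
                q ^ (clusterCount (↑(insert s(s, m) (N₁ \ γ₁ ∪ A₁)) : BondConfig V) ∅ + clusterCount (↑(γ₁ ∪ C₁) : BondConfig V) ∅)) * g (γ₁ ∪ γ₂) +
            (if (openGraph (↑(N₂ \ γ₂ ∪ A₂) : BondConfig V)).Reachable m t then 0 else 1) *
              q ^ (clusterCount (↑(N₂ \ γ₂ ∪ A₂) : BondConfig V) ∅ + clusterCount (↑(γ₂ ∪ C₂) : BondConfig V) ∅) *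
              ∑ γ₁ ∈ N₁.powerset, (q ^ (clusterCount (↑(γ₁ ∪ A₁) : BondConfig V) ∅ + clusterCount (↑(N₁ \ γ₁ ∪ C₁) : BondConfig V) ∅) -
                q ^ (clusterCount (↑(N₁ \ γ₁ ∪ A₁) : BondConfig V) ∅ + clusterCount (↑(γ₁ ∪ C₁) : BondConfig V) ∅)) * g (γ₁ ∪ γ₂)) +
        ∑ γ₁ ∈ N₁.powerset,
          ((if (openGraph (↑(γ₁ ∪ A₁) : BondConfig V)).Reachable s m then 1 else 0) *
              q ^ (clusterCount (↑(γ₁ ∪ A₁) : BondConfig V) ∅ + clusterCount (↑(N₁ \ γ₁ ∪ C₁) : BondConfig V) ∅ + 1) *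
              ∑ γ₂ ∈ N₂.powerset, (q ^ (clusterCount (↑(insert s(m, t) (γ₂ ∪ A₂)) : BondConfig V) ∅ + clusterCount (↑(N₂ \ γ₂ ∪ C₂) : BondConfig V) ∅) -
                q ^ (clusterCount (↑(insert s(m, t) (N₂ \ γ₂ ∪ A₂)) : BondConfig V) ∅ + clusterCount (↑(γ₂ ∪ C₂) : BondConfig V) ∅)) * g (γ₁ ∪ γ₂) +
            (if (openGraph (↑(γ₁ ∪ A₁) : BondConfig V)).Reachable s m then 0 else 1) *
              q ^ (clusterCount (↑(γ₁ ∪ A₁) : BondConfig V) ∅ + clusterCount (↑(N₁ \ γ₁ ∪ C₁) : BondConfig V) ∅) *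
              ∑ γ₂ ∈ N₂.powerset, (q ^ (clusterCount (↑(γ₂ ∪ A₂) : BondConfig V) ∅ + clusterCount (↑(N₂ \ γ₂ ∪ C₂) : BondConfig V) ∅) -
                q ^ (clusterCount (↑(N₂ \ γ₂ ∪ A₂) : BondConfig V) ∅ + clusterCount (↑(γ₂ ∪ C₂) : BondConfig V) ∅)) * g (γ₁ ∪ γ₂)) := by
  rw [Finset.mul_sum, sum_powerset_union_disj hd]
  simp_rw [Finset.mul_sum, ← Finset.sum_add_distrib]
  rw [Finset.sum_comm (s := N₂.powerset) (t := N₁.powerset), ← Finset.sum_add_distrib]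
  refine Finset.sum_congr rfl fun γ₁ hγ₁ => ?_
  rw [← Finset.sum_add_distrib]
  refine Finset.sum_congr rfl fun γ₂ hγ₂ => ?_
  rw [Finset.mem_powerset] at hγ₁ hγ₂
  rw [union_sdiff_union hd hγ₁ hγ₂, Finset.union_union_union_comm γ₁ γ₂ A₁ A₂,
    Finset.union_union_union_comm (N₁ \ γ₁) (N₂ \ γ₂) C₁ C₂, Finset.union_union_union_comm (N₁ \ γ₁) (N₂ \ γ₂) A₁ A₂,
    Finset.union_union_union_comm γ₁ γ₂ C₁ C₂,
    andGen_summand_series q h₁ h₂ hS hsV₂ htV₁ hsm htm hst hN₁ hA₁ hC₁ hN₂ hA₂ hC₂ hγ₁ hγ₂ (g (γ₁ ∪ γ₂))]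
  ring

/-- **The general AND-drift across a series junction (abstract form).**  If on side 1 the general AND-drifts with root `sm` and without root
(attached `A₁`, contracted `C₁`) are `≤ 0` on every monotone test function, and likewise on side 2 with root `mt`, then the general AND-drift of
the composite with root `st` (attached `A₁ ∪ A₂`, contracted `C₁ ∪ C₂`) is `≤ 0` on every monotone `g` (`q > 0`).
[cite: Grimmett2006, §3.8 Thm. (3.90) (pp. 61–62)] -/
theorem andGen_series_nonpos {q : ℝ} (hq : 0 < q) (h₁ : ∀ e ∈ (↑E₁ : Set (Sym2 V)), ∀ z ∈ e, z ∈ V₁)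
    (h₂ : ∀ e ∈ (↑E₂ : Set (Sym2 V)), ∀ z ∈ e, z ∈ V₂) (hS : V₁ ∩ V₂ ⊆ {m}) (hsV₂ : s ∉ V₂) (htV₁ : t ∉ V₁)
    (hsm : s ≠ m) (htm : t ≠ m) (hst : s ≠ t)
    {N₁ A₁ C₁ N₂ A₂ C₂ : Finset (Sym2 V)} (hd : Disjoint N₁ N₂) (hN₁ : N₁ ⊆ E₁) (hA₁ : A₁ ⊆ E₁) (hC₁ : C₁ ⊆ E₁)
    (hN₂ : N₂ ⊆ E₂) (hA₂ : A₂ ⊆ E₂) (hC₂ : C₂ ⊆ E₂)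
    (hY₁ : ∀ h' : Finset (Sym2 V) → ℝ, (∀ ⦃A B : Finset (Sym2 V)⦄, A ⊆ B → B ⊆ N₁ → h' A ≤ h' B) →
      ∑ γ₁ ∈ N₁.powerset, (q ^ (clusterCount (↑(insert s(s, m) (γ₁ ∪ A₁)) : BondConfig V) ∅ + clusterCount (↑(N₁ \ γ₁ ∪ C₁) : BondConfig V) ∅) -
        q ^ (clusterCount (↑(insert s(s, m) (N₁ \ γ₁ ∪ A₁)) : BondConfig V) ∅ + clusterCount (↑(γ₁ ∪ C₁) : BondConfig V) ∅)) * h' γ₁ ≤ 0)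
    (hL₁ : ∀ h' : Finset (Sym2 V) → ℝ, (∀ ⦃A B : Finset (Sym2 V)⦄, A ⊆ B → B ⊆ N₁ → h' A ≤ h' B) →
      ∑ γ₁ ∈ N₁.powerset, (q ^ (clusterCount (↑(γ₁ ∪ A₁) : BondConfig V) ∅ + clusterCount (↑(N₁ \ γ₁ ∪ C₁) : BondConfig V) ∅) -
        q ^ (clusterCount (↑(N₁ \ γ₁ ∪ A₁) : BondConfig V) ∅ + clusterCount (↑(γ₁ ∪ C₁) : BondConfig V) ∅)) * h' γ₁ ≤ 0)
    (hY₂ : ∀ h' : Finset (Sym2 V) → ℝ, (∀ ⦃A B : Finset (Sym2 V)⦄, A ⊆ B → B ⊆ N₂ → h' A ≤ h' B) →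
      ∑ γ₂ ∈ N₂.powerset, (q ^ (clusterCount (↑(insert s(m, t) (γ₂ ∪ A₂)) : BondConfig V) ∅ + clusterCount (↑(N₂ \ γ₂ ∪ C₂) : BondConfig V) ∅) -
        q ^ (clusterCount (↑(insert s(m, t) (N₂ \ γ₂ ∪ A₂)) : BondConfig V) ∅ + clusterCount (↑(γ₂ ∪ C₂) : BondConfig V) ∅)) * h' γ₂ ≤ 0)
    (hL₂ : ∀ h' : Finset (Sym2 V) → ℝ, (∀ ⦃A B : Finset (Sym2 V)⦄, A ⊆ B → B ⊆ N₂ → h' A ≤ h' B) →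
      ∑ γ₂ ∈ N₂.powerset, (q ^ (clusterCount (↑(γ₂ ∪ A₂) : BondConfig V) ∅ + clusterCount (↑(N₂ \ γ₂ ∪ C₂) : BondConfig V) ∅) -
        q ^ (clusterCount (↑(N₂ \ γ₂ ∪ A₂) : BondConfig V) ∅ + clusterCount (↑(γ₂ ∪ C₂) : BondConfig V) ∅)) * h' γ₂ ≤ 0)
    {g : Finset (Sym2 V) → ℝ} (hmono : ∀ ⦃A B : Finset (Sym2 V)⦄, A ⊆ B → B ⊆ N₁ ∪ N₂ → g A ≤ g B) :
    ∑ γ ∈ (N₁ ∪ N₂).powerset,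
        (q ^ (clusterCount (↑(insert s(s, t) (γ ∪ (A₁ ∪ A₂))) : BondConfig V) ∅ +
              clusterCount (↑((N₁ ∪ N₂) \ γ ∪ (C₁ ∪ C₂)) : BondConfig V) ∅) -
          q ^ (clusterCount (↑(insert s(s, t) ((N₁ ∪ N₂) \ γ ∪ (A₁ ∪ A₂))) : BondConfig V) ∅ +
              clusterCount (↑(γ ∪ (C₁ ∪ C₂)) : BondConfig V) ∅)) * g γ ≤ 0 := by
  have hpos : 0 < q ^ (2 * Fintype.card V + 1) := pow_pos hq _
  have key := andGen_series_eq q h₁ h₂ hS hsV₂ htV₁ hsm htm hst hd hN₁ hA₁ hC₁ hN₂ hA₂ hC₂ g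
  suffices hle : q ^ (2 * Fintype.card V + 1) *
      ∑ γ ∈ (N₁ ∪ N₂).powerset,
        (q ^ (clusterCount (↑(insert s(s, t) (γ ∪ (A₁ ∪ A₂))) : BondConfig V) ∅ +
              clusterCount (↑((N₁ ∪ N₂) \ γ ∪ (C₁ ∪ C₂)) : BondConfig V) ∅) -
          q ^ (clusterCount (↑(insert s(s, t) ((N₁ ∪ N₂) \ γ ∪ (A₁ ∪ A₂))) : BondConfig V) ∅ +
              clusterCount (↑(γ ∪ (C₁ ∪ C₂)) : BondConfig V) ∅)) * g γ ≤ 0 by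
    by_contra hcon
    exact absurd hle (not_le.2 (mul_pos hpos (not_le.1 hcon)))
  rw [key]
  have sec₁ : ∀ γ₂ ∈ N₂.powerset, ∀ ⦃A B : Finset (Sym2 V)⦄, A ⊆ B → B ⊆ N₁ → g (A ∪ γ₂) ≤ g (B ∪ γ₂) := by
    intro γ₂ hγ₂ A B hAB hB
    rw [Finset.mem_powerset] at hγ₂
    exact hmono (Finset.union_subset_union hAB le_rfl) (Finset.union_subset_union hB hγ₂)
  have sec₂ : ∀ γ₁ ∈ N₁.powerset, ∀ ⦃A B : Finset (Sym2 V)⦄, A ⊆ B → B ⊆ N₂ → g (γ₁ ∪ A) ≤ g (γ₁ ∪ B) := by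
    intro γ₁ hγ₁ A B hAB hB
    rw [Finset.mem_powerset] at hγ₁
    exact hmono (Finset.union_subset_union le_rfl hAB) (Finset.union_subset_union hγ₁ hB)
  refine add_nonpos (Finset.sum_nonpos fun γ₂ hγ₂ => ?_) (Finset.sum_nonpos fun γ₁ hγ₁ => ?_)
  · have i₁ := hY₁ (fun γ₁ => g (γ₁ ∪ γ₂)) (sec₁ γ₂ hγ₂)
    have i₂ := hL₁ (fun γ₁ => g (γ₁ ∪ γ₂)) (sec₁ γ₂ hγ₂)
    refine add_nonpos (mul_nonpos_of_nonneg_of_nonpos (mul_nonneg ?_ (pow_nonneg hq.le _)) i₁)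
      (mul_nonpos_of_nonneg_of_nonpos (mul_nonneg ?_ (pow_nonneg hq.le _)) i₂) <;>
    split_ifs <;> norm_num
  · have i₁ := hY₂ (fun γ₂ => g (γ₁ ∪ γ₂)) (sec₂ γ₁ hγ₁)
    have i₂ := hL₂ (fun γ₂ => g (γ₁ ∪ γ₂)) (sec₂ γ₁ hγ₁)
    refine add_nonpos (mul_nonpos_of_nonneg_of_nonpos (mul_nonneg ?_ (pow_nonneg hq.le _)) i₁)
      (mul_nonpos_of_nonneg_of_nonpos (mul_nonneg ?_ (pow_nonneg hq.le _)) i₂) <;>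
    split_ifs <;> norm_num

end GenSeries

end FK

end Summit.CriticalPhenomena.PercolationContinuityZ3.Theorems

end
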